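import Summits.Ventures.PercRepro.Night2FatDegFree
import Summits.Ventures.PercRepro.Night2FatZThreeB

/-!
# night-2: the witnesses of the singly degenerate regime — a side point and free points — the cases P₂ = ∅ and P₂ = {c}

For every lossy basis pair of the singly degenerate regime (the side points `M = π₃ ∖ L` collinear, the points of
`π₂` off the spine of rank `≥ 3`, the spine a class line), `W ∖ {x}` contains a side point `y₃` and either two free
points, or a second side point and one free point (**`exists_side_and_free_deg`**).  The basis points split as
`L₀ ∪ P₂ ∪ P₃` (on the spine / in `π₂` off it / side), `|L₀| ≤ 2`, `|L₀ ∪ P₂| ≤ 3`, `|P₃| ≤ 2`; the side points of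
`W ∖ {x}` number `|M| − |P₃| ≥ 1`; the free points come from `π₂` off the class basis lines through the basis
points of `π₂` (at most one class basis line through a basis point off the spine, `no_two_class_lines_through_off`)
or from the spine (`free_of_spine_point`), case by case on `|P₂| ∈ {0, 1, 2, 3}`.
Paper `proofs/NIGHT-2-g35.md` §4.
-/

namespace PercRepro.Shadow

open PercRepro.ThmH PercRepro.PerFlat

variable {α : Type*} [DecidableEq α] {M : Matroid α} [M.Finite] {G : Finset α}

/-- A side point and two free points when `P₂ = ∅`: every point of `π₂` off the spine is a free point of `W`. -/
theorem deg_wit_large_case_p2_empty {w₀ x : α} {R₁ : Finset α} {c₂ c₃ : α} {B : Finset α} {z : α}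
    (hd : (gr M \ G).card = 2) (hk : kColoops M G = 1) (hfat : (fatClosures M 5 G 2).card ≤ 1) (hR₁2 : rkN M R₁ = 2)
    (hR₁3 : 3 ≤ R₁.card) (hcop : rkN M (insert w₀ (insert x R₁)) ≤ 3)
    (hnd₂ : 3 ≤ rkN M (((G \ coloops M G) \ {w₀, x}).filter (fun e => e ∈ clF M (insert c₂ R₁) ∧ e ∉ clF M R₁)))
    (hdeg₃ : rkN M (((G \ coloops M G) \ {w₀, x}).filter (fun e => e ∈ clF M (insert c₃ R₁) ∧ e ∉ clF M R₁)) ≤ 2)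
    {V P W Mset P₃ M' L₀ P₂ Aset Lset : Finset α} (hV : V = (G \ coloops M G) \ {w₀, x})
    (hP : P = (insert z B \ coloops M G).erase w₀) (hW : W = (G \ insert z B).erase x)
    (hMset : Mset = V.filter (fun e => e ∈ clF M (insert c₃ R₁) ∧ e ∉ clF M R₁))
    (hP₃ : P₃ = P.filter (fun e => e ∈ Mset)) (hM' : M' = W.filter (fun e => e ∈ Mset))
    (hL₀ : L₀ = P.filter (fun e => e ∈ clF M R₁))
    (hP₂ : P₂ = P.filter (fun e => e ∈ clF M (insert c₂ R₁) ∧ e ∉ clF M R₁))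
    (hAset : Aset = V.filter (fun e => e ∈ clF M (insert c₂ R₁) ∧ e ∉ clF M R₁))
    (hLset : Lset = V.filter (fun e => e ∈ clF M R₁)) {y₃ : α} (hP4 : P.card = 4) (hM3 : 3 ≤ Mset.card)
    (hM2 : 1 < Mset.card) (hP₃2 : P₃.card ≤ 2) (hMsplit : Mset.card = P₃.card + M'.card) (hM'1 : 1 ≤ M'.card)
    (hL₀2 : L₀.card ≤ 2) (hπ₂3 : (P.filter (fun e => e ∈ clF M (insert c₂ R₁))).card ≤ 3)
    (hL₀P₂ : L₀.card + P₂.card ≤ 3) (hsplit : L₀.card + P₂.card + P₃.card = 4) (hAW : ∀ e ∈ Aset, e ∉ P₂ → e ∈ W)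
    (hL3 : 3 ≤ Lset.card)
    (hfreeA : ∀ f ∈ Aset, f ∈ W → (∀ a ∈ L₀, ∀ c ∈ P₂, a ≠ c → f ∈ clF M {a, c} → rkN M (insert w₀ (insert x {a,
      c})) ≤ 3 → 4 ≤ rkN M ({a, c} ∪ Mset)) → (∀ c ∈ P₂, ∀ c' ∈ P₂, c ≠ c' → f ∈ clF M {c, c'} → rkN M (insert w₀
      (insert x {c, c'})) ≤ 3 → 4 ≤ rkN M ({c, c'} ∪ Mset)) → f ∉ clF M Mset ∧ ∀ a ∈ P, ∀ b ∈ P, a ≠ b → f ∈ clF M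
      {a, b} → rkN M (insert w₀ (insert x {a, b})) ≤ 3 → 4 ≤ rkN M ({a, b} ∪ Mset))
    (hA3 : 3 ≤ Aset.card) (hP₂0 : P₂.card < 1) :
    ((∃ f₁ ∈ (G \ insert z B).erase x, ∃ f₂ ∈ (G \ insert z B).erase x, f₁ ≠ f₂ ∧ (f₁ ∉ clF M (((G \ coloops M G)
      \ {w₀, x}).filter (fun e => e ∈ clF M (insert c₃ R₁) ∧ e ∉ clF M R₁)) ∧ ∀ a ∈ (insert z B \ coloops M G).erase
      w₀, ∀ b ∈ (insert z B \ coloops M G).erase w₀, a ≠ b → f₁ ∈ clF M {a, b} → rkN M (insert w₀ (insert x {a, b}))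
      ≤ 3 → 4 ≤ rkN M ({a, b} ∪ ((G \ coloops M G) \ {w₀, x}).filter (fun e => e ∈ clF M (insert c₃ R₁) ∧ e ∉ clF M
      R₁))) ∧ (f₂ ∉ clF M (((G \ coloops M G) \ {w₀, x}).filter (fun e => e ∈ clF M (insert c₃ R₁) ∧ e ∉ clF M R₁))
      ∧ ∀ a ∈ (insert z B \ coloops M G).erase w₀, ∀ b ∈ (insert z B \ coloops M G).erase w₀, a ≠ b → f₂ ∈ clF M {a,
      b} → rkN M (insert w₀ (insert x {a, b})) ≤ 3 → 4 ≤ rkN M ({a, b} ∪ ((G \ coloops M G) \ {w₀, x}).filter (fun e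
      => e ∈ clF M (insert c₃ R₁) ∧ e ∉ clF M R₁)))) ∨ (∃ y₃' ∈ (G \ insert z B).erase x, y₃' ≠ y₃ ∧ (y₃' ∈ clF M
      (insert c₃ R₁) ∧ y₃' ∉ clF M R₁) ∧ ∃ f ∈ (G \ insert z B).erase x, f ∉ clF M (((G \ coloops M G) \ {w₀,
      x}).filter (fun e => e ∈ clF M (insert c₃ R₁) ∧ e ∉ clF M R₁)) ∧ ∀ a ∈ (insert z B \ coloops M G).erase w₀, ∀
      b ∈ (insert z B \ coloops M G).erase w₀, a ≠ b → f ∈ clF M {a, b} → rkN M (insert w₀ (insert x {a, b})) ≤ 3 →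
      4 ≤ rkN M ({a, b} ∪ ((G \ coloops M G) \ {w₀, x}).filter (fun e => e ∈ clF M (insert c₃ R₁) ∧ e ∉ clF M R₁)))) := by
  subst hV hP hW hMset hP₃ hM' hL₀ hP₂ hAset hLset
  set V := (G \ coloops M G) \ {w₀, x} with hV
  set P := (insert z B \ coloops M G).erase w₀ with hP
  set W := (G \ insert z B).erase x with hW
  set Mset := V.filter (fun e => e ∈ clF M (insert c₃ R₁) ∧ e ∉ clF M R₁) with hMset
  set P₃ := P.filter (fun e => e ∈ Mset) with hP₃
  set M' := W.filter (fun e => e ∈ Mset) with hM'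
  set L₀ := P.filter (fun e => e ∈ clF M R₁) with hL₀
  set P₂ := P.filter (fun e => e ∈ clF M (insert c₂ R₁) ∧ e ∉ clF M R₁) with hP₂
  set Aset := V.filter (fun e => e ∈ clF M (insert c₂ R₁) ∧ e ∉ clF M R₁) with hAset
  set Lset := V.filter (fun e => e ∈ clF M R₁) with hLset
  have _u := hd
  have _u := hk
  have _u := hfat
  have _u := hR₁2
  have _u := hR₁3
  have _u := hcop
  have _u := hnd₂
  have _u := hdeg₃
  have _u := hP4
  have _u := hM3
  have _u := hM2
  have _u := hP₃2
  have _u := hMsplit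
  have _u := hM'1
  have _u := hL₀2
  have _u := hπ₂3
  have _u := hL₀P₂
  have _u := hsplit
  have _u := hL3
  have _u := hA3
  have _u := hP₂0
  left
  have hP₂e : P₂ = ∅ := Finset.card_eq_zero.1 (by omega)
  obtain ⟨f₁, hf₁, f₂, hf₂, hf₁₂⟩ := Finset.one_lt_card.1 (by omega : 1 < Aset.card)
  have hnoP₂ : ∀ c, c ∉ P₂ := fun c hc => by rw [hP₂e] at hc; exact Finset.notMem_empty _ hc
  have hfree : ∀ f ∈ Aset, f ∈ W ∧ (f ∉ clF M Mset ∧ ∀ a ∈ P, ∀ b ∈ P, a ≠ b → f ∈ clF M {a, b} →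
      rkN M (insert w₀ (insert x {a, b})) ≤ 3 → 4 ≤ rkN M ({a, b} ∪ Mset)) := by
    intro f hf
    have hfW : f ∈ W := hAW f hf (hnoP₂ f)
    exact ⟨hfW, hfreeA f hf hfW (fun a _ c hc => absurd hc (hnoP₂ c)) (fun c hc => absurd hc (hnoP₂ c))⟩
  exact ⟨f₁, (hfree f₁ hf₁).1, f₂, (hfree f₂ hf₂).1, hf₁₂, (hfree f₁ hf₁).2, (hfree f₂ hf₂).2⟩

/-- A side point and two free points, or two side points and a free point, when `P₂ = {c}`. -/
theorem deg_wit_large_case_p2_one {w₀ x : α} {R₁ : Finset α} {c₂ c₃ : α} {B : Finset α} {z : α}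
    (hd : (gr M \ G).card = 2) (hk : kColoops M G = 1) (hs : ∀ e ∈ gr M, ∀ f ∈ gr M, e ≠ f → rkN M {e, f} = 2)
    (hfat : (fatClosures M 5 G 2).card ≤ 1) (hR₁2 : rkN M R₁ = 2) (hR₁3 : 3 ≤ R₁.card)
    (hcop : rkN M (insert w₀ (insert x R₁)) ≤ 3)
    (hnd₂ : 3 ≤ rkN M (((G \ coloops M G) \ {w₀, x}).filter (fun e => e ∈ clF M (insert c₂ R₁) ∧ e ∉ clF M R₁)))
    (hdeg₃ : rkN M (((G \ coloops M G) \ {w₀, x}).filter (fun e => e ∈ clF M (insert c₃ R₁) ∧ e ∉ clF M R₁)) ≤ 2)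
    {V P W Mset P₃ M' L₀ P₂ Aset Lset : Finset α} (hV : V = (G \ coloops M G) \ {w₀, x})
    (hP : P = (insert z B \ coloops M G).erase w₀) (hW : W = (G \ insert z B).erase x)
    (hMset : Mset = V.filter (fun e => e ∈ clF M (insert c₃ R₁) ∧ e ∉ clF M R₁))
    (hP₃ : P₃ = P.filter (fun e => e ∈ Mset)) (hM' : M' = W.filter (fun e => e ∈ Mset))
    (hL₀ : L₀ = P.filter (fun e => e ∈ clF M R₁))
    (hP₂ : P₂ = P.filter (fun e => e ∈ clF M (insert c₂ R₁) ∧ e ∉ clF M R₁))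
    (hAset : Aset = V.filter (fun e => e ∈ clF M (insert c₂ R₁) ∧ e ∉ clF M R₁))
    (hLset : Lset = V.filter (fun e => e ∈ clF M R₁)) {y₃ : α} (hVg : V ⊆ gr M) (hPV : P ⊆ V) (hP4 : P.card = 4)
    (hM3 : 3 ≤ Mset.card) (hM2 : 1 < Mset.card) (hP₃2 : P₃.card ≤ 2) (hMsplit : Mset.card = P₃.card + M'.card)
    (hM'1 : 1 ≤ M'.card) (hL₀2 : L₀.card ≤ 2) (hπ₂3 : (P.filter (fun e => e ∈ clF M (insert c₂ R₁))).card ≤ 3)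
    (hL₀P₂ : L₀.card + P₂.card ≤ 3) (hsplit : L₀.card + P₂.card + P₃.card = 4) (hAW : ∀ e ∈ Aset, e ∉ P₂ → e ∈ W)
    (hL3 : 3 ≤ Lset.card) (hLW : ∀ e ∈ Lset, e ∉ L₀ → e ∈ W)
    (hLM : ∀ s ∈ Lset, ∀ s' ∈ Lset, s ≠ s' → s ∈ clF M Mset → s' ∉ clF M Mset)
    (hspineM : ∀ a ∈ L₀, ∀ c ∈ P₂, rkN M ({a, c} ∪ Mset) ≤ 3 → a ∈ clF M Mset)
    (htwo : P₃.card ≤ 1 → ∃ y₃' ∈ W, y₃' ≠ y₃ ∧ (y₃' ∈ clF M (insert c₃ R₁) ∧ y₃' ∉ clF M R₁))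
    (hfreeL : L₀.card ≤ 1 → ∀ s ∈ W, s ∈ clF M R₁ → s ∉ clF M Mset → (∀ c ∈ P₂, ∀ c' ∈ P₂, c ≠ c' → s ∈ clF M {c,
      c'} → rkN M (insert w₀ (insert x {c, c'})) ≤ 3 → 4 ≤ rkN M ({c, c'} ∪ Mset)) → s ∉ clF M Mset ∧ ∀ a ∈ P, ∀ b ∈
      P, a ≠ b → s ∈ clF M {a, b} → rkN M (insert w₀ (insert x {a, b})) ≤ 3 → 4 ≤ rkN M ({a, b} ∪ Mset))
    (hfreeA : ∀ f ∈ Aset, f ∈ W → (∀ a ∈ L₀, ∀ c ∈ P₂, a ≠ c → f ∈ clF M {a, c} → rkN M (insert w₀ (insert x {a,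
      c})) ≤ 3 → 4 ≤ rkN M ({a, c} ∪ Mset)) → (∀ c ∈ P₂, ∀ c' ∈ P₂, c ≠ c' → f ∈ clF M {c, c'} → rkN M (insert w₀
      (insert x {c, c'})) ≤ 3 → 4 ≤ rkN M ({c, c'} ∪ Mset)) → f ∉ clF M Mset ∧ ∀ a ∈ P, ∀ b ∈ P, a ≠ b → f ∈ clF M
      {a, b} → rkN M (insert w₀ (insert x {a, b})) ≤ 3 → 4 ≤ rkN M ({a, b} ∪ Mset))
    (hAoff : ∀ X : Finset α, rkN M X ≤ 2 → ∃ f ∈ Aset, f ∉ clF M X) (hA3 : 3 ≤ Aset.card) (hP₂1 : 1 ≤ P₂.card)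
    (hP₂1' : P₂.card < 2) :
    ((∃ f₁ ∈ (G \ insert z B).erase x, ∃ f₂ ∈ (G \ insert z B).erase x, f₁ ≠ f₂ ∧ (f₁ ∉ clF M (((G \ coloops M G)
      \ {w₀, x}).filter (fun e => e ∈ clF M (insert c₃ R₁) ∧ e ∉ clF M R₁)) ∧ ∀ a ∈ (insert z B \ coloops M G).erase
      w₀, ∀ b ∈ (insert z B \ coloops M G).erase w₀, a ≠ b → f₁ ∈ clF M {a, b} → rkN M (insert w₀ (insert x {a, b}))
      ≤ 3 → 4 ≤ rkN M ({a, b} ∪ ((G \ coloops M G) \ {w₀, x}).filter (fun e => e ∈ clF M (insert c₃ R₁) ∧ e ∉ clF M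
      R₁))) ∧ (f₂ ∉ clF M (((G \ coloops M G) \ {w₀, x}).filter (fun e => e ∈ clF M (insert c₃ R₁) ∧ e ∉ clF M R₁))
      ∧ ∀ a ∈ (insert z B \ coloops M G).erase w₀, ∀ b ∈ (insert z B \ coloops M G).erase w₀, a ≠ b → f₂ ∈ clF M {a,
      b} → rkN M (insert w₀ (insert x {a, b})) ≤ 3 → 4 ≤ rkN M ({a, b} ∪ ((G \ coloops M G) \ {w₀, x}).filter (fun e
      => e ∈ clF M (insert c₃ R₁) ∧ e ∉ clF M R₁)))) ∨ (∃ y₃' ∈ (G \ insert z B).erase x, y₃' ≠ y₃ ∧ (y₃' ∈ clF M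
      (insert c₃ R₁) ∧ y₃' ∉ clF M R₁) ∧ ∃ f ∈ (G \ insert z B).erase x, f ∉ clF M (((G \ coloops M G) \ {w₀,
      x}).filter (fun e => e ∈ clF M (insert c₃ R₁) ∧ e ∉ clF M R₁)) ∧ ∀ a ∈ (insert z B \ coloops M G).erase w₀, ∀
      b ∈ (insert z B \ coloops M G).erase w₀, a ≠ b → f ∈ clF M {a, b} → rkN M (insert w₀ (insert x {a, b})) ≤ 3 →
      4 ≤ rkN M ({a, b} ∪ ((G \ coloops M G) \ {w₀, x}).filter (fun e => e ∈ clF M (insert c₃ R₁) ∧ e ∉ clF M R₁)))) := by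
  subst hV hP hW hMset hP₃ hM' hL₀ hP₂ hAset hLset
  set V := (G \ coloops M G) \ {w₀, x} with hV
  set P := (insert z B \ coloops M G).erase w₀ with hP
  set W := (G \ insert z B).erase x with hW
  set Mset := V.filter (fun e => e ∈ clF M (insert c₃ R₁) ∧ e ∉ clF M R₁) with hMset
  set P₃ := P.filter (fun e => e ∈ Mset) with hP₃
  set M' := W.filter (fun e => e ∈ Mset) with hM'
  set L₀ := P.filter (fun e => e ∈ clF M R₁) with hL₀
  set P₂ := P.filter (fun e => e ∈ clF M (insert c₂ R₁) ∧ e ∉ clF M R₁) with hP₂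
  set Aset := V.filter (fun e => e ∈ clF M (insert c₂ R₁) ∧ e ∉ clF M R₁) with hAset
  set Lset := V.filter (fun e => e ∈ clF M R₁) with hLset
  have _u := hd
  have _u := hk
  have _u := hfat
  have _u := hR₁2
  have _u := hR₁3
  have _u := hcop
  have _u := hnd₂
  have _u := hdeg₃
  have _u := hP4
  have _u := hM3
  have _u := hM2
  have _u := hP₃2
  have _u := hMsplit
  have _u := hM'1
  have _u := hL₀2
  have _u := hπ₂3
  have _u := hL₀P₂
  have _u := hsplit
  have _u := hL3
  have _u := hA3
  have _u := hP₂1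
  have _u := hP₂1'
  obtain ⟨c, hcP₂⟩ := Finset.card_eq_one.1 (by omega : P₂.card = 1)
  have hcmem : c ∈ P₂ := by rw [hcP₂]; exact Finset.mem_singleton_self c
  have hcP : c ∈ P := (Finset.mem_filter.1 hcmem).1
  have hcA : c ∈ Aset := Finset.mem_filter.2 ⟨hPV hcP, (Finset.mem_filter.1 hcmem).2⟩
  have hcg : c ∈ gr M := hVg (hPV hcP)
  have honly : ∀ c' ∈ P₂, c' = c := fun c' hc' => by rw [hcP₂, Finset.mem_singleton] at hc'; exact hc'
  -- the class lines through `c` and a spine basis point in `clF M`: at most one spine point is in `clF M`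
  -- a free point of `π₂`: off `clF {a₀, c}` for the (possible) spine basis point `a₀ ∈ clF M`
  have hfreeA' : ∃ f ∈ Aset, f ∈ W ∧ (f ∉ clF M Mset ∧ ∀ a ∈ P, ∀ b ∈ P, a ≠ b → f ∈ clF M {a, b} →
      rkN M (insert w₀ (insert x {a, b})) ≤ 3 → 4 ≤ rkN M ({a, b} ∪ Mset)) := by
    by_cases hex : ∃ a₀ ∈ L₀, a₀ ∈ clF M Mset
    · obtain ⟨a₀, ha₀, ha₀M⟩ := hex
      have ha₀g : a₀ ∈ gr M := hVg (hPV (Finset.mem_filter.1 ha₀).1)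
      have ha₀c : a₀ ≠ c := by
        rintro rfl
        exact (Finset.mem_filter.1 hcmem).2.2 (Finset.mem_filter.1 ha₀).2
      obtain ⟨f, hf, hfoff⟩ := hAoff {a₀, c} (by rw [hs a₀ ha₀g c hcg ha₀c])
      have hfc : f ≠ c := by
        rintro rfl
        exact hfoff (subset_clF_of_subset_gr (Finset.insert_subset ha₀g (Finset.singleton_subset_iff.2 hcg))
          (Finset.mem_insert_of_mem (Finset.mem_singleton_self _)))
      have hfW : f ∈ W := hAW f hf (fun h => hfc (honly f h))
      refine ⟨f, hf, hfW, hfreeA f hf hfW ?_ ?_⟩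
      · intro a ha c' hc' hac hfac hcls
        by_contra hcopl
        push Not at hcopl
        have hc'c : c' = c := honly c' hc'
        subst hc'c
        have haM : a ∈ clF M Mset := hspineM a ha c' hcmem (by omega)
        -- `a` and `a₀` are both spine points of `clF M`, hence equal
        have haa₀ : a = a₀ := by
          by_contra hne'
          exact hLM a (Finset.mem_filter.2 ⟨hPV (Finset.mem_filter.1 ha).1, (Finset.mem_filter.1 ha).2⟩)
            a₀ (Finset.mem_filter.2 ⟨hPV (Finset.mem_filter.1 ha₀).1, (Finset.mem_filter.1 ha₀).2⟩) hne' haM ha₀M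
        subst haa₀
        exact hfoff hfac
      · intro c' hc' c'' hc'' hne'
        exact absurd ((honly c' hc').trans (honly c'' hc'').symm) hne'
    · push Not at hex
      obtain ⟨f, hf, hfoff⟩ := hAoff {c} (by
        have := rkN_le_card (M := M) ({c} : Finset α)
        simp at this
        omega)
      have hfc : f ≠ c := by
        rintro rfl
        exact hfoff (subset_clF_of_subset_gr (Finset.singleton_subset_iff.2 hcg) (Finset.mem_singleton_self _))
      have hfW : f ∈ W := hAW f hf (fun h => hfc (honly f h))
      refine ⟨f, hf, hfW, hfreeA f hf hfW ?_ ?_⟩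
      · intro a ha c' hc' hac hfac hcls
        by_contra hcopl
        push Not at hcopl
        have hc'c : c' = c := honly c' hc'
        subst hc'c
        exact hex a ha (hspineM a ha c' hcmem (by omega))
      · intro c' hc' c'' hc'' hne'
        exact absurd ((honly c' hc').trans (honly c'' hc'').symm) hne'
  obtain ⟨f, hf, hfW, hffree⟩ := hfreeA'
  rcases Nat.lt_or_ge P₃.card 2 with hP₃1 | hP₃2
  · -- two side points
    right
    obtain ⟨y₃', hy₃'W, hyy, hy₃'side⟩ := htwo (by omega)
    exact ⟨y₃', hy₃'W, hyy, hy₃'side, f, hfW, hffree⟩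
  · -- `|P₃| = 2`, `|L₀| = 1`: a second free point on the spine
    left
    have hL₀1 : L₀.card = 1 := by omega
    -- two spine points of `W`; one of them is off `clF M`
    have hLW2 : 1 < (Lset.filter (fun e => e ∈ W)).card := by
      have hsplitL : Lset.card = (Lset.filter (fun e => e ∈ W)).card + (Lset.filter (fun e => ¬ e ∈ W)).card :=
        (Finset.card_filter_add_card_filter_not (s := Lset) _).symm
      have hsub : Lset.filter (fun e => ¬ e ∈ W) ⊆ L₀ := by
        intro e he
        rw [Finset.mem_filter] at he
        by_contra heL₀
        exact he.2 (hLW e he.1 heL₀)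
      have := Finset.card_le_card hsub
      omega
    obtain ⟨s, hsm, s', hs'm, hss'⟩ := Finset.one_lt_card.1 hLW2
    rw [Finset.mem_filter] at hsm hs'm
    have hcc : ∀ t ∈ W, t ∈ clF M R₁ → ∀ c' ∈ P₂, ∀ c'' ∈ P₂, c' ≠ c'' → t ∈ clF M {c', c''} →
        rkN M (insert w₀ (insert x {c', c''})) ≤ 3 → 4 ≤ rkN M ({c', c''} ∪ Mset) := by
      intro t _ _ c' hc' c'' hc'' hne'
      exact absurd ((honly c' hc').trans (honly c'' hc'').symm) hne'
    by_cases hsM : s ∈ clF M Mset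
    · have hs'M : s' ∉ clF M Mset := hLM s hsm.1 s' hs'm.1 hss' hsM
      have hs'free := hfreeL (by omega) s' hs'm.2 (Finset.mem_filter.1 hs'm.1).2 hs'M (hcc s' hs'm.2
        (Finset.mem_filter.1 hs'm.1).2)
      have hfs' : f ≠ s' := by
        rintro rfl
        exact (Finset.mem_filter.1 hf).2.2 (Finset.mem_filter.1 hs'm.1).2
      exact ⟨f, hfW, s', hs'm.2, hfs', hffree, hs'free⟩
    · have hsfree := hfreeL (by omega) s hsm.2 (Finset.mem_filter.1 hsm.1).2 hsM (hcc s hsm.2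
        (Finset.mem_filter.1 hsm.1).2)
      have hfs : f ≠ s := by
        rintro rfl
        exact (Finset.mem_filter.1 hf).2.2 (Finset.mem_filter.1 hsm.1).2
      exact ⟨f, hfW, s, hsm.2, hfs, hffree, hsfree⟩

end PercRepro.Shadow
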